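import Summits.QuantumFields.YangMills.Theorems.BalabanLadderIRStubShellRung
import Literature.MathematicalPhysics.QuantumFieldTheory.YangMillsOS
import Literature.MathematicalPhysics.QuantumLattice.GaugeGroupsProofs

/-!
# Onset-mixing formats of crux `IR`: the registered T cut is a weakening of the expired g0 cut; its typed bet
(a MASS wire refutes `OnsetMixingTypical`)
(Q-g18 disprove lineage, g3; Negative lane of crux `BalabanLadder.IR`, item stmt-QuantumFields-19354)

Two crux-plan cuts of `IR` are concerned, neither a tree module; §0 mirrors their vocabulary VERBATIM (so the
statements below are the skeletons' up to namespace):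
* the EXPIRED cut `af-pincer` g0 (skeleton sha16 022967c699dbe563; stub `stub_onset : OnsetMixing`, expired
  2026-08-27T02:23:44Z): `shellCount` (:89), `UnivShellCond` (:101), `mixSet` (:112), `mixOnset` (:118),
  `OnsetMixing` (:205);
* the REGISTERED hedge cut `af-pincer-T` (skeleton sha16 0308f95ca6f6a115; stubs `stub_onsetT : OnsetMixingTypical`,
  `stub_typCriterion`, `stub_afOnsetT`): `TypShellCond` (:165–184), `OnsetMixingTypical` (:199–204).

Findings (kernel-checked, no `sorry`; the hypotheses `MassWireAt` / `MassWire` are `def … : Prop`, never asserted):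

* §1 `typShellCond_of_univShellCond`, `onsetMixingTypical_of_onsetMixing` — format T is implied by the g0 format at
  every parameter point (`Typ ≡ univ` has rarity `0`): the registered stub I_T is a WEAKENING of the expired stub I,
  so an H-world refutes I_T only if it refutes I.  The converse fails for the sup-`ζ` boundary-order wires of the
  sibling module `OnsetMixingFalseOfUniformWire` (uniform / central-face wire ⇒ `¬ OnsetMixing`): clause (i_T) only
  compares data TYPICAL on every cell off `Y`, and a frozen frustrated face (a density-one layer of action-`2`
  plaquettes) is excludable by a cell-local `Typ` at rarity cost `→ 0` as `b → ∞`.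
* §2 What DOES bite format T is typed here.  `MassWireAt ρ β b n p`: two sets of data of TORUS mass `≥ p` on all
  large tori polarising a centre-cell observable (`≤ 1/3` vs `≥ 2/3`) through the FULLY RESAMPLED window
  `Y = windowCells n` (only shell data differ).  `not_typShellCond_of_massWireAt`: it kills `TypShellCond` at every
  rarity budget `0 ≤ δ` with `#shell · δ < p` and every `ε < 1/3` — the torus anchor (iii_T) on shell singletons plus
  a union bound over the shell leave lifts in BOTH polarising sets that are typical on every shell cell, and with `Y`
  the whole window the agreement clause of (i_T) is void.  `MassWire r.ρ` (one `p > 0`, every mesh `b ≥ 1`, every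
  window `n ≥ 1`, all large `β`) for ONE lattice representation of ONE compact simple `G` refutes `OnsetMixingTypical`
  (`not_onsetMixingTypical_of_massWireSU2`) — no `NT`, no `LowerBounds`, no unit map.
* This TYPES stub I_T's bet: `∀ G r, ¬ MassWire r.ρ` — at each large `β` SOME mesh has no positive-mass pair of
  boundary classes polarising the centre through a resampled window, i.e. Gibbs-typical boundary influence dies at
  some scale (uniqueness-and-mixing AMONG TYPICAL DATA; tuned walls are not quantified over).  Deciding `MassWire`
  for 4-D `SU(2)` is a finite-correlation-length question; nothing here is a theorem about `IR`, and the verdict for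
  the registered cut is NOT-REFUTED (memo `pub/ym-beyond/ym-19354-disprove-1/NOT-REFUTED.md` §8).

Imports are Theses-free (no route-file cone).
-/

noncomputable section

open Filter Topology MeasureTheory
open Literature.MathematicalPhysics.QuantumFieldTheory Literature.MathematicalPhysics.QuantumLattice
open Literature.Probability.LatticeModels
open Summit.QuantumFields.YangMills.Cruxes.IR.Tempered (cellEdges windowCells regionEdges)
open Summit.QuantumFields.YangMills.Cruxes.IR.ShellTempered (windowCellsPlus)

namespace Summit.QuantumFields.YangMills.Cruxes.IR.OnsetFormats

/-! ## §0 Verbatim mirrors of the two skeletons' vocabulary -/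

/-- mirror of `AfPincer.shellCount` = `AfPincerT.shellCount`: `M(n) = (4n+3)⁴ − (4n+1)⁴`, `M(1) = 1776`;
`(n, ε)` is ADMISSIBLE when `1 ≤ n`, `0 ≤ ε`, `ε · M(n) < 1`. -/
def shellCount (n : ℕ) : ℝ := ((((4 * n + 3) ^ 4 - (4 * n + 1) ^ 4 : ℕ)) : ℝ)

section Defs

variable {G : Type} [Group G] [TopologicalSpace G] [IsTopologicalGroup G] [CompactSpace G]
  [MeasurableSpace G] [BorelSpace G]

/-- mirror of `AfPincer.UnivShellCond` (g0 :101): untempered sub-region strong mixing at mesh `b`. -/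
def UnivShellCond {N : ℕ} (ρ : G →* Matrix (Fin N) (Fin N) ℂ) (β : ℝ) (b n : ℕ) (ε : ℝ) : Prop :=
  ∀ w : Fin 4 → ℤ → ℤ, (∀ i j, w i j + ((b : ℕ) : ℤ) ≤ w i (j + 1) ∧ w i (j + 1) ≤ w i j + 2 * ((b : ℕ) : ℤ)) →
    ∀ Y : Finset (Fin 4 → ℤ), Y ⊆ windowCells n → (0 : Fin 4 → ℤ) ∈ Y →
      ∀ σ σ' : LGConfig 4 G,
        (∀ c ∈ windowCellsPlus n, c ∉ Y → c ∈ windowCells n → ∀ e ∈ cellEdges w c, σ e = σ' e) →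
        ∀ f : LGConfig 4 G → ℝ, IsCylinder f (cellEdges w 0) → Measurable f → (∀ U, 0 ≤ f U ∧ f U ≤ 1) →
          |(∫ U, f U ∂(ymSpecification ρ β (regionEdges w Y) σ)) -
            ∫ U, f U ∂(ymSpecification ρ β (regionEdges w Y) σ')| ≤ ε

/-- mirror of `AfPincer.mixSet` (g0 :112): the mixing meshes. -/
def mixSet {N : ℕ} (ρ : G →* Matrix (Fin N) (Fin N) ℂ) (β : ℝ) (n : ℕ) (ε : ℝ) : Set ℕ :=
  {b : ℕ | 1 ≤ b ∧ UnivShellCond ρ β b n ε}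

/-- mirror of `AfPincer.mixOnset` (g0 :118): the mixing onset (`sInf`, junk `0`). -/
def mixOnset {N : ℕ} (ρ : G →* Matrix (Fin N) (Fin N) ℂ) (β : ℝ) (n : ℕ) (ε : ℝ) : ℕ :=
  sInf (mixSet ρ β n ε)

/-- mirror of `AfPincerT.TypShellCond` (T :165–184, the REGISTERED format): typical-data shell condition with
(i_T) sub-region mixing for pairs typical off `Y`, (ii_T) hereditary joint rarity, (iii_T) torus anchor. -/
def TypShellCond {N : ℕ} (ρ : G →* Matrix (Fin N) (Fin N) ℂ) (β : ℝ) (b n : ℕ) (ε δ : ℝ) : Prop :=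
  ∀ w : Fin 4 → ℤ → ℤ, (∀ i j, w i j + ((b : ℕ) : ℤ) ≤ w i (j + 1) ∧ w i (j + 1) ≤ w i j + 2 * ((b : ℕ) : ℤ)) →
    ∃ Typ : (Fin 4 → ℤ) → Set (LGConfig 4 G),
      (∀ c, MeasurableSet (Typ c)) ∧ (∀ c, DependsOn (fun σ : LGConfig 4 G => σ ∈ Typ c) ↑(cellEdges w c)) ∧
      (∀ Y : Finset (Fin 4 → ℤ), Y ⊆ windowCells n → (0 : Fin 4 → ℤ) ∈ Y →
        ∀ σ σ' : LGConfig 4 G,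
          (∀ c ∈ windowCellsPlus n, c ∉ Y → σ ∈ Typ c ∧ σ' ∈ Typ c) →
          (∀ c ∈ windowCellsPlus n, c ∉ Y → c ∈ windowCells n → ∀ e ∈ cellEdges w c, σ e = σ' e) →
          ∀ f : LGConfig 4 G → ℝ, IsCylinder f (cellEdges w 0) → Measurable f → (∀ U, 0 ≤ f U ∧ f U ≤ 1) →
            |(∫ U, f U ∂(ymSpecification ρ β (regionEdges w Y) σ)) -
              ∫ U, f U ∂(ymSpecification ρ β (regionEdges w Y) σ')| ≤ ε) ∧
      (∀ F F' : Finset (Fin 4 → ℤ), F ⊆ F' → F.Nonempty → ∀ ζ : LGConfig 4 G,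
        (∀ c' : Fin 4 → ℤ, c' ∉ F' → (∃ c ∈ F', ∀ i, |c' i - c i| ≤ 1) → ζ ∈ Typ c') →
          (ymSpecification ρ β (regionEdges w F') ζ) {σ : LGConfig 4 G | ∀ c ∈ F, σ ∉ Typ c} ≤
            ENNReal.ofReal (δ ^ F.card)) ∧
      (∀ S : ℕ, 4 * b ≤ 2 * S + 1 → ∀ F : Finset (Fin 4 → ℤ), F.Nonempty →
        (∀ c ∈ F, ∀ i, -(S : ℤ) ≤ w i (c i) ∧ w i (c i + 1) ≤ (S : ℤ) + 1) →
          (wilsonMeasure (d := 4) (L := 2 * S + 1) ρ β)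
              {V : GaugeConfig 4 (2 * S + 1) G | ∀ c ∈ F, torusLift (2 * S + 1) V ∉ Typ c} ≤
            ENNReal.ofReal (δ ^ F.card))

end Defs

/-- mirror of `AfPincer.OnsetMixing` (g0 :205) — the EXPIRED stub statement `stub_onset`, verbatim. -/
def OnsetMixing : Prop :=
  ∀ (G : Type) [Group G] [TopologicalSpace G] [IsTopologicalGroup G] [CompactSpace G],
    IsCompactSimpleLieGroup G → letI : MeasurableSpace G := borel G; haveI : BorelSpace G := ⟨rfl⟩;
    ∀ r : LatticeRep G, ∃ (n : ℕ) (ε : ℝ), 1 ≤ n ∧ 0 ≤ ε ∧ ε * shellCount n < 1 ∧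
      ∃ β₂ : ℝ, ∀ β : ℝ, β₂ ≤ β → ∃ b : ℕ, 1 ≤ b ∧ UnivShellCond r.ρ β b n ε

/-- mirror of `AfPincerT.OnsetMixingTypical` (T :199) — the REGISTERED stub statement `stub_onsetT`, verbatim. -/
def OnsetMixingTypical : Prop :=
  ∀ (G : Type) [Group G] [TopologicalSpace G] [IsTopologicalGroup G] [CompactSpace G],
    IsCompactSimpleLieGroup G → letI : MeasurableSpace G := borel G; haveI : BorelSpace G := ⟨rfl⟩;
    ∀ r : LatticeRep G, ∃ (n : ℕ) (ε : ℝ), 1 ≤ n ∧ 0 ≤ ε ∧ ε * shellCount n < 1 ∧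
      ∀ δ : ℝ, 0 < δ → ∃ β₂ : ℝ, ∀ β : ℝ, β₂ ≤ β → ∃ b : ℕ, 1 ≤ b ∧ TypShellCond r.ρ β b n ε δ

/-! ## §1 Format T is implied by the g0 format (at every parameter point) -/

section Formats

variable {G : Type} [Group G] [TopologicalSpace G] [IsTopologicalGroup G] [CompactSpace G]
  [MeasurableSpace G] [BorelSpace G]

/-- **`UnivShellCond ⇒ TypShellCond` at every rarity budget** (`Typ ≡ univ`: clauses (ii_T), (iii_T) bound the
measure of the EMPTY set). -/
theorem typShellCond_of_univShellCond {N : ℕ} {ρ : G →* Matrix (Fin N) (Fin N) ℂ} {β : ℝ} {b n : ℕ} {ε : ℝ}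
    (hU : UnivShellCond ρ β b n ε) (δ : ℝ) : TypShellCond ρ β b n ε δ := by
  intro w hw
  refine ⟨fun _ => Set.univ, fun _ => MeasurableSet.univ, ?_, ?_, ?_, ?_⟩
  · intro c x y _
    simp
  · intro Y hY h0 σ σ' _ hagree f hf hfm hf01
    exact hU w hw Y hY h0 σ σ' hagree f hf hfm hf01
  · intro F F' _ hF ζ _
    obtain ⟨c, hc⟩ := hF
    have hsub : {σ : LGConfig 4 G | ∀ c ∈ F, σ ∉ (Set.univ : Set (LGConfig 4 G))} ⊆ ∅ :=
      fun σ hσ => hσ c hc (Set.mem_univ σ)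
    exact (measure_mono hsub).trans (by simp)
  · intro S _ F hF _
    obtain ⟨c, hc⟩ := hF
    have hsub : {V : GaugeConfig 4 (2 * S + 1) G | ∀ c ∈ F, torusLift (2 * S + 1) V ∉ (Set.univ : Set (LGConfig 4 G))}
        ⊆ ∅ := fun V hV => hV c hc (Set.mem_univ _)
    exact (measure_mono hsub).trans (by simp)

end Formats

/-- **The registered stub is a weakening of the expired one:** `OnsetMixing → OnsetMixingTypical`.  Hence an H-world
refutes the T cut's stub I_T only if it refutes the g0 stub, and the sup-`ζ` wires of the sibling module
`OnsetMixingFalseOfUniformWire`, which do refute the g0 stub, need a separate argument against T (§2 here types the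
hypothesis shape that bites). -/
theorem onsetMixingTypical_of_onsetMixing (h : OnsetMixing) : OnsetMixingTypical := by
  intro G _ _ _ _ hG
  letI : MeasurableSpace G := borel G
  haveI : BorelSpace G := ⟨rfl⟩
  intro r
  obtain ⟨n, ε, hn, hε, hM, β₂, hon⟩ := h G hG r
  refine ⟨n, ε, hn, hε, hM, fun δ _ => ⟨β₂, fun β hβ => ?_⟩⟩
  obtain ⟨b, hb, hU⟩ := hon β hβ
  exact ⟨b, hb, typShellCond_of_univShellCond hU δ⟩

section Arith

/-- Admissible `(n, ε)` have `ε < 1/3` (`M(n) ≥ 16`). -/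
theorem eps_lt_third_of_admissible {n : ℕ} {ε : ℝ} (hM : ε * shellCount n < 1) : ε < 1 / 3 := by
  have h16 : 16 ≤ (4 * n + 3) ^ 4 - (4 * n + 1) ^ 4 := by
    apply Nat.le_sub_of_add_le
    calc 16 + (4 * n + 1) ^ 4
        ≤ 16 + (4 * n + 1) ^ 4 + (8 * (4 * n + 1) ^ 3 + 24 * (4 * n + 1) ^ 2 + 32 * (4 * n + 1)) :=
          Nat.le_add_right _ _
      _ = (4 * n + 3) ^ 4 := by ring
  have hMge : (16 : ℝ) ≤ shellCount n := by
    unfold shellCount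
    exact_mod_cast h16
  by_contra hge
  rw [not_lt] at hge
  nlinarith

/-- The centre cell is a window cell. -/
theorem zero_mem_windowCells (n : ℕ) : (0 : Fin 4 → ℤ) ∈ windowCells n := by
  simp only [windowCells, Fintype.mem_piFinset, Finset.mem_Icc, Pi.zero_apply]
  intro i
  constructor <;> omega

end Arith

/-! ## §2 The T side: a MASS wire kills the typical-data condition; `MassWire` types stub I_T's bet -/

section Mass

variable {G : Type} [Group G] [TopologicalSpace G] [IsTopologicalGroup G] [CompactSpace G]
  [MeasurableSpace G] [BorelSpace G]

/-- **Mass wire at one parameter point** `(ρ, β, b, n, p)`: a frame `w` of mesh `b`, a `[0,1]`-valued measurable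
centre-cell cylinder `f`, two sets `S₀, S₁` of data and a torus threshold `S₁*` such that (a) every datum of `S₀`
gives `∫ f dγ_{window}(σ) ≤ 1/3` and every datum of `S₁` gives `≥ 2/3` — polarisation of the centre cell THROUGH THE
FULLY RESAMPLED WINDOW `Y = windowCells n`, so only shell data differ — and (b) on every torus of side `2S+1`,
`S ≥ S₁*`, the periodic Wilson state gives the periodic lifts landing in `S₀`, resp. `S₁`, mass `≥ p` each.  The two
classes are thus GIBBS-TYPICAL with a mass floor, not frozen designs. -/
def MassWireAt {N : ℕ} (ρ : G →* Matrix (Fin N) (Fin N) ℂ) (β : ℝ) (b n : ℕ) (p : ℝ) : Prop :=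
  ∃ w : Fin 4 → ℤ → ℤ, (∀ i j, w i j + ((b : ℕ) : ℤ) ≤ w i (j + 1) ∧ w i (j + 1) ≤ w i j + 2 * ((b : ℕ) : ℤ)) ∧
    ∃ (f : LGConfig 4 G → ℝ) (S₀ S₁ : Set (LGConfig 4 G)) (Sthr : ℕ),
      IsCylinder f (cellEdges w 0) ∧ Measurable f ∧ (∀ U, 0 ≤ f U ∧ f U ≤ 1) ∧
      (∀ σ ∈ S₀, ∫ U, f U ∂(ymSpecification ρ β (regionEdges w (windowCells n)) σ) ≤ 1 / 3) ∧
      (∀ σ ∈ S₁, 2 / 3 ≤ ∫ U, f U ∂(ymSpecification ρ β (regionEdges w (windowCells n)) σ)) ∧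
      (∀ S : ℕ, Sthr ≤ S →
        ENNReal.ofReal p ≤ (wilsonMeasure (d := 4) (L := 2 * S + 1) ρ β)
            {V : GaugeConfig 4 (2 * S + 1) G | torusLift (2 * S + 1) V ∈ S₀} ∧
        ENNReal.ofReal p ≤ (wilsonMeasure (d := 4) (L := 2 * S + 1) ρ β)
            {V : GaugeConfig 4 (2 * S + 1) G | torusLift (2 * S + 1) V ∈ S₁})

/-- **Mass wire** for the Wilson kernels of `ρ` (the typed hypothesis of the T side): ONE mass floor `p > 0` and one
threshold `β₀` beyond which `MassWireAt ρ β b n p` holds at EVERY mesh `b ≥ 1` and every window `n ≥ 1`. -/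
def MassWire {N : ℕ} (ρ : G →* Matrix (Fin N) (Fin N) ℂ) : Prop :=
  ∃ p : ℝ, 0 < p ∧ ∃ β₀ : ℝ, ∀ β : ℝ, β₀ ≤ β → ∀ b n : ℕ, 1 ≤ b → 1 ≤ n → MassWireAt ρ β b n p

/-- **A mass wire kills the typical-data condition at every small rarity budget** (`#shell · δ < p`, `0 ≤ δ`,
`ε < 1/3`).  Proof: on a torus large enough for the frame's shell cells and the mass floor, clause (iii_T) on each
shell singleton bounds the atypical lifts by `δ`; a union bound over the shell (`< p`) leaves lifts in `S₀` and in
`S₁` that are typical on EVERY shell cell; with `Y = windowCells n` the agreement clause of (i_T) is void, so (i_T)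
bounds the polarisation `≥ 1/3` by `ε`. -/
theorem not_typShellCond_of_massWireAt {N : ℕ} {ρ : G →* Matrix (Fin N) (Fin N) ℂ} {β : ℝ} {b n : ℕ}
    {ε δ p : ℝ} (hW : MassWireAt ρ β b n p) (hε : ε < 1 / 3) (hδ : 0 ≤ δ)
    (hδp : ((windowCellsPlus n \ windowCells n).card : ℝ) * δ < p) : ¬ TypShellCond ρ β b n ε δ := by
  intro hT
  obtain ⟨w, hw, f, S₀, S₁, Sthr, hf, hfm, hf01, hlo, hhi, hmass⟩ := hW
  obtain ⟨Typ, -, -, hi, -, hiii⟩ := hT w hw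
  -- a bound on the frame coordinates of the shell cells
  set J : Finset (Fin 4 × ℤ) := Finset.univ ×ˢ Finset.Icc (-(2 * (n : ℤ) + 1)) (2 * (n : ℤ) + 2) with hJ
  set K : ℕ := J.sup fun q => (w q.1 q.2).natAbs with hK
  have hKle : ∀ q ∈ J, (w q.1 q.2).natAbs ≤ K := fun q hq =>
    Finset.le_sup (f := fun q : Fin 4 × ℤ => (w q.1 q.2).natAbs) hq
  obtain ⟨S, hS1, hS2, hS3⟩ : ∃ S : ℕ, Sthr ≤ S ∧ K ≤ S ∧ 2 * b ≤ S :=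
    ⟨Sthr + K + 2 * b, by omega, by omega, by omega⟩
  have h4b : 4 * b ≤ 2 * S + 1 := by omega
  set μ := wilsonMeasure (d := 4) (L := 2 * S + 1) ρ β with hμ
  -- (iii_T) on shell singletons
  have hcell : ∀ c ∈ windowCellsPlus n \ windowCells n,
      μ {V : GaugeConfig 4 (2 * S + 1) G | torusLift (2 * S + 1) V ∉ Typ c} ≤ ENNReal.ofReal δ := by
    intro c hc
    have hcP : c ∈ windowCellsPlus n := (Finset.mem_sdiff.mp hc).1
    have hci : ∀ i, -(2 * (n : ℤ) + 1) ≤ c i ∧ c i ≤ 2 * (n : ℤ) + 1 := fun i =>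
      Finset.mem_Icc.mp (Fintype.mem_piFinset.mp hcP i)
    have hdom : ∀ c' ∈ ({c} : Finset (Fin 4 → ℤ)), ∀ i, -(S : ℤ) ≤ w i (c' i) ∧ w i (c' i + 1) ≤ (S : ℤ) + 1 := by
      intro c' hc' i
      rw [Finset.mem_singleton] at hc'
      subst hc'
      have h1 : (w i (c' i)).natAbs ≤ K := hKle (i, c' i)
        (Finset.mem_product.mpr ⟨Finset.mem_univ _, Finset.mem_Icc.mpr ⟨by linarith [hci i], by linarith [hci i]⟩⟩)
      have h2 : (w i (c' i + 1)).natAbs ≤ K := hKle (i, c' i + 1)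
        (Finset.mem_product.mpr ⟨Finset.mem_univ _, Finset.mem_Icc.mpr ⟨by linarith [hci i], by linarith [hci i]⟩⟩)
      constructor <;> omega
    have h := hiii S h4b {c} (Finset.singleton_nonempty c) hdom
    simpa only [Finset.mem_singleton, forall_eq, Finset.card_singleton, pow_one] using h
  -- union bound over the shell
  set Bad : Set (GaugeConfig 4 (2 * S + 1) G) :=
    ⋃ c ∈ windowCellsPlus n \ windowCells n, {V | torusLift (2 * S + 1) V ∉ Typ c} with hBad
  have hBad_le : μ Bad ≤ ENNReal.ofReal (((windowCellsPlus n \ windowCells n).card : ℝ) * δ) := by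
    calc μ Bad ≤ ∑ c ∈ windowCellsPlus n \ windowCells n, μ {V | torusLift (2 * S + 1) V ∉ Typ c} :=
          measure_biUnion_finset_le _ _
      _ ≤ (windowCellsPlus n \ windowCells n).card • ENNReal.ofReal δ := Finset.sum_le_card_nsmul _ _ _ hcell
      _ = ENNReal.ofReal (((windowCellsPlus n \ windowCells n).card : ℝ) * δ) := by
          rw [nsmul_eq_mul, ENNReal.ofReal_mul (Nat.cast_nonneg _), ENNReal.ofReal_natCast]
  have hp : 0 < p := lt_of_le_of_lt (mul_nonneg (Nat.cast_nonneg _) hδ) hδp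
  have hBad_lt : μ Bad < ENNReal.ofReal p :=
    lt_of_le_of_lt hBad_le ((ENNReal.ofReal_lt_ofReal_iff hp).mpr hδp)
  have hgood : ∀ V, V ∉ Bad → ∀ c ∈ windowCellsPlus n, c ∉ windowCells n → torusLift (2 * S + 1) V ∈ Typ c := by
    intro V hV c hcP hcW
    by_contra hnot
    exact hV (Set.mem_biUnion (Finset.mem_sdiff.mpr ⟨hcP, hcW⟩) hnot)
  -- jointly typical polarising lifts
  obtain ⟨hm0, hm1⟩ := hmass S hS1
  have hex : ∀ T : Set (LGConfig 4 G), ENNReal.ofReal p ≤ μ {V | torusLift (2 * S + 1) V ∈ T} →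
      ∃ V : GaugeConfig 4 (2 * S + 1) G, torusLift (2 * S + 1) V ∈ T ∧ V ∉ Bad := by
    intro T hT
    by_contra hno
    have hsub : {V : GaugeConfig 4 (2 * S + 1) G | torusLift (2 * S + 1) V ∈ T} ⊆ Bad := fun V hV => by
      by_contra hVB
      exact hno ⟨V, hV, hVB⟩
    exact absurd (hT.trans (measure_mono hsub)) (not_le.mpr hBad_lt)
  obtain ⟨V₀, hV₀, hV₀B⟩ := hex S₀ hm0
  obtain ⟨V₁, hV₁, hV₁B⟩ := hex S₁ hm1
  have hmix := hi (windowCells n) subset_rfl (zero_mem_windowCells n)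
    (torusLift (2 * S + 1) V₀) (torusLift (2 * S + 1) V₁)
    (fun c hc hcY => ⟨hgood V₀ hV₀B c hc hcY, hgood V₁ hV₁B c hc hcY⟩)
    (fun c _ hcY hcW => absurd hcW hcY) f hf hfm hf01
  have h0 := hlo _ hV₀
  have h1 := hhi _ hV₁
  have habs := le_abs_self ((∫ U, f U ∂(ymSpecification ρ β (regionEdges w (windowCells n)) (torusLift (2 * S + 1) V₁))) -
    ∫ U, f U ∂(ymSpecification ρ β (regionEdges w (windowCells n)) (torusLift (2 * S + 1) V₀)))
  rw [abs_sub_comm] at habs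
  linarith

/-- **`MassWire r.ρ` refutes stub I_T's conclusion at `(G, r)`** — for every admissible `(n, ε)`, at the budget
`δ = p / (2 (#shell + 1))`, NO mesh is typically mixing at large `β`.  No `NT`, no unit map, no simplicity. -/
theorem onsetMixingTypicalAt_false_of_massWire (r : LatticeRep G) (hW : MassWire r.ρ) :
    ¬ ∃ (n : ℕ) (ε : ℝ), 1 ≤ n ∧ 0 ≤ ε ∧ ε * shellCount n < 1 ∧
        ∀ δ : ℝ, 0 < δ → ∃ β₂ : ℝ, ∀ β : ℝ, β₂ ≤ β → ∃ b : ℕ, 1 ≤ b ∧ TypShellCond r.ρ β b n ε δ := by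
  rintro ⟨n, ε, hn, -, hM, hIδ⟩
  obtain ⟨p, hp, β₀, hwire⟩ := hW
  set k : ℕ := (windowCellsPlus n \ windowCells n).card with hk
  have hδ0 : 0 < p / (2 * ((k : ℝ) + 1)) := by positivity
  obtain ⟨β₂, hon⟩ := hIδ (p / (2 * ((k : ℝ) + 1))) hδ0
  obtain ⟨b, hb, hT⟩ := hon (max β₀ β₂) (le_max_right _ _)
  refine not_typShellCond_of_massWireAt (hwire _ (le_max_left _ _) b n hb hn) (eps_lt_third_of_admissible hM)
    hδ0.le ?_ hT
  have hk0 : (0 : ℝ) ≤ k := Nat.cast_nonneg _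
  have hlt : (k : ℝ) / (2 * ((k : ℝ) + 1)) < 1 := by
    rw [div_lt_one (by positivity)]
    linarith
  calc (k : ℝ) * (p / (2 * ((k : ℝ) + 1))) = p * ((k : ℝ) / (2 * ((k : ℝ) + 1))) := by ring
    _ < p * 1 := mul_lt_mul_of_pos_left hlt hp
    _ = p := mul_one p

end Mass

/-- **`MassWire` for ONE lattice representation of ONE compact simple `G` refutes the REGISTERED stub statement
`OnsetMixingTypical`.** -/
theorem not_onsetMixingTypical_of_massWire (G : Type) [Group G] [TopologicalSpace G] [IsTopologicalGroup G]
    [CompactSpace G] (hG : IsCompactSimpleLieGroup G)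
    (hW : letI : MeasurableSpace G := borel G; haveI : BorelSpace G := ⟨rfl⟩;
      ∃ r : LatticeRep G, MassWire r.ρ) : ¬ OnsetMixingTypical := by
  intro hI
  letI : MeasurableSpace G := borel G
  haveI : BorelSpace G := ⟨rfl⟩
  obtain ⟨r, hWr⟩ := hW
  exact onsetMixingTypicalAt_false_of_massWire r hWr (hI G hG r)

/-- `SU(2)` instance: a mass wire for any one lattice representation of `SU(2)` refutes `OnsetMixingTypical`.  This
TYPES stub I_T's bet: `¬ MassWire r.ρ` for every `r` of every compact simple `G` — at each large `β` SOME mesh has no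
positive-mass pair of boundary classes polarising the centre through a resampled window. -/
theorem not_onsetMixingTypical_of_massWireSU2
    (hW : letI : MeasurableSpace (Matrix.specialUnitaryGroup (Fin 2) ℂ) :=
        borel (Matrix.specialUnitaryGroup (Fin 2) ℂ);
      haveI : BorelSpace (Matrix.specialUnitaryGroup (Fin 2) ℂ) := ⟨rfl⟩;
      ∃ r : LatticeRep (Matrix.specialUnitaryGroup (Fin 2) ℂ), MassWire r.ρ) : ¬ OnsetMixingTypical :=
  not_onsetMixingTypical_of_massWire _
    (isCompactSimpleLieGroup_specialUnitaryGroup isSimpleCompactGroup_specialUnitaryGroup_holds le_rfl) hW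

end Summit.QuantumFields.YangMills.Cruxes.IR.OnsetFormats

end
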